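import Summits.AnomalousDissipation.AnomalousDissipation.Theorems.BaireTransferDenseLoudDesignerForcesErgodicLine
import Literature.Analysis.FunctionSpaces.TorusLinearisedNSGrowth

/-!
# The linearised Navier–Stokes flow along trajectories: uniqueness and Lyapunov growth (line `ergodic-budget-selection-closing`,
# crux `BaireTransfer.DenseLoudDesignerForces`, stmt-AnomalousDissipation-1143) — the Summit bridge of block N4

Sorry-free (fourth lead c3-0, 2026-08-16): the line's predicate `IsLinearizedNSSolutionOn S ν u w q` (file `…ErgodicLine.lean`: classical
solutions of `∂ₜw + (u·∇)w + (w·∇)u = νΔw − ∇q`, `div w = 0`, mean zero) read against the landed Literature block N4 (lead's wave-2 worker):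
`Literature/Analysis/FunctionSpaces/TorusLinearisedNSEnergy.lean` (p110904), `…TorusLinearisedNSGrowth.lean` (p112069).

* `IsLinearizedNSSolutionOn.unique_Ici` (registered stub `linearised_unique_Ici`) — UNIQUENESS OF THE LINEARISED FLOW: along a classical
  solution `u` of NS_ν on `[0,∞) × T³` (`ν ≥ 0`), two linearised solutions with the same initial value coincide for all `t ≥ 0`; in
  particular the derivative cocycle of the semiflow, read through `IsLinearizedNSSolutionOn`, is a well-defined (single-valued) object and
  the shift `a` in the hyperbolicity clause of `IsHyperbolicMeasure` acts on ONE solution per initial datum;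
* `IsLinearizedNSSolutionOn.integral_norm_sq_nat_le` (registered stub `linearised_growth_nat`) — LYAPUNOV GROWTH: if the background has
  bounded gradients `‖∂ᵢu‖ ≤ Cᵢ` on `[0,∞) × T³` (true along trajectories of a compact invariant set of strong solutions — block N1), then
  `∫‖w(n)‖² ≤ (∫‖w(0)‖²) e^{2(∑Cᵢ)n}`: every linearised solution has forward Lyapunov exponent `≤ ∑ᵢ Cᵢ`, so `SubExpGrowth`/`ExpDecay`
  (exponents `≤ 0` / `< 0`) are statements about a bounded spectrum, and the zero solution is the only one decaying faster than every
  exponential rate compatible with `e^{-2(∑Cᵢ)n}` backwards (not formalised).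

References: P. Constantin, C. Foias, *Navier–Stokes Equations* (1988) Ch. 14 (14.2)–(14.4); R. Temam, *Infinite-Dimensional Dynamical
Systems* (1997) Ch. VII §2.1.
-/

set_option linter.dupNamespace false

noncomputable section

open scoped BigOperators Topology ENNReal InnerProductSpace
open Filter Set Function MeasureTheory

namespace Summit.AnomalousDissipation.AnomalousDissipation.Theorems.DenseLoudDesignerForces.Ergodic

open Literature.Analysis.FunctionSpaces Literature.Analysis.FunctionSpaces.Torus
open Literature.Analysis.FluidPDE Literature.Analysis.FluidPDE.Torus
open Summit.AnomalousDissipation.AnomalousDissipation.Theses.BaireTransfer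
open Summit.AnomalousDissipation.AnomalousDissipation.Theorems.DenseLoudDesignerForces.Negative

section LinearisedBridge

variable {ν : ℝ} {F : (UnitAddTorus (Fin 3)) → (EuclideanSpace ℝ (Fin 3))}
  {u : ℝ → (UnitAddTorus (Fin 3)) → (EuclideanSpace ℝ (Fin 3))} {p : ℝ → (UnitAddTorus (Fin 3)) → ℝ}

/-- **Uniqueness of the linearised flow along a classical trajectory** (registered stub `linearised_unique_Ici`): two solutions of the
linearised Navier–Stokes equation along the same classical solution `u` of NS_ν(F) on `[0,∞) × T³` (`ν ≥ 0`) with `w₁ 0 = w₂ 0` agree at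
every `t ≥ 0` (energy method, `Literature.Analysis.FunctionSpaces.Torus.linearisedNS_unique_Ici`). [folklore] -/
theorem linearised_unique_Ici (hν : 0 ≤ ν) (hsol : IsClassicalNSSolutionOn (Ici 0) ν (fun _ => F) u p)
    {w₁ w₂ : ℝ → (UnitAddTorus (Fin 3)) → (EuclideanSpace ℝ (Fin 3))} {q₁ q₂ : ℝ → (UnitAddTorus (Fin 3)) → ℝ}
    (h₁ : IsLinearizedNSSolutionOn (Ici 0) ν u w₁ q₁) (h₂ : IsLinearizedNSSolutionOn (Ici 0) ν u w₂ q₂) (h0 : w₁ 0 = w₂ 0)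
    {t : ℝ} (ht : 0 ≤ t) : w₁ t = w₂ t :=
  linearisedNS_unique_Ici hν hsol.smooth_velocity (fun t ht => hsol.divFree t ht) h₁.1 h₁.2.1 h₁.2.2.1 h₁.2.2.2.2
    h₂.1 h₂.2.1 h₂.2.2.1 h₂.2.2.2.2 h0 ht

/-- **Lyapunov growth of the linearised flow** (registered stub `linearised_growth_nat`): along a classical solution `u` of NS_ν(F) on
`[0,∞) × T³` (`ν ≥ 0`) whose gradients are bounded, `‖∂ᵢu(t,x)‖ ≤ Cᵢ`, every linearised solution satisfies
`∫‖w(n)‖² ≤ (∫‖w(0)‖²)·e^{2(∑ᵢCᵢ)n}` at the integer times (`Literature.Analysis.FunctionSpaces.Torus.linearisedNS_integral_norm_sq_nat_le_mul_exp`):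
forward Lyapunov exponents of the linearised cocycle are `≤ ∑ᵢ Cᵢ`. [folklore] -/
theorem linearised_growth_nat (hν : 0 ≤ ν) (hsol : IsClassicalNSSolutionOn (Ici 0) ν (fun _ => F) u p)
    {w : ℝ → (UnitAddTorus (Fin 3)) → (EuclideanSpace ℝ (Fin 3))} {q : ℝ → (UnitAddTorus (Fin 3)) → ℝ}
    (h : IsLinearizedNSSolutionOn (Ici 0) ν u w q) {C : Fin 3 → ℝ}
    (hC : ∀ i, ∀ t ∈ Ici (0 : ℝ), ∀ x, ‖partialDeriv i (u t) x‖ ≤ C i) (n : ℕ) :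
    ∫ x, ‖w n x‖ ^ 2 ≤ (∫ x, ‖w 0 x‖ ^ 2) * Real.exp ((2 * ∑ i, C i) * n) :=
  linearisedNS_integral_norm_sq_nat_le_mul_exp hν hsol.smooth_velocity (fun t ht => hsol.divFree t ht) h.1 h.2.1 h.2.2.1 h.2.2.2.2 hC n

/-- Under bounded background gradients every linearised solution has (at most) exponential growth at the rate `2∑Cᵢ`; in particular a
solution with `ExpDecay` or `SubExpGrowth` is consistent, and `SubExpGrowth` holds as soon as `2∑ᵢCᵢ ≤ 0`… — recorded in the usable
direction: the growth bound packaged as a witness for any rate `κ ≥ 2∑Cᵢ`. [folklore] -/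
theorem linearised_le_exp_of_rate (hν : 0 ≤ ν) (hsol : IsClassicalNSSolutionOn (Ici 0) ν (fun _ => F) u p)
    {w : ℝ → (UnitAddTorus (Fin 3)) → (EuclideanSpace ℝ (Fin 3))} {q : ℝ → (UnitAddTorus (Fin 3)) → ℝ}
    (h : IsLinearizedNSSolutionOn (Ici 0) ν u w q) {C : Fin 3 → ℝ}
    (hC : ∀ i, ∀ t ∈ Ici (0 : ℝ), ∀ x, ‖partialDeriv i (u t) x‖ ≤ C i) {κ : ℝ} (hκ : 2 * ∑ i, C i ≤ κ) (n : ℕ) :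
    ∫ x, ‖w n x‖ ^ 2 ≤ (∫ x, ‖w 0 x‖ ^ 2) * Real.exp (κ * n) := by
  refine (linearised_growth_nat hν hsol h hC n).trans ?_
  refine mul_le_mul_of_nonneg_left (Real.exp_le_exp.2 ?_) (integral_nonneg fun x => sq_nonneg _)
  exact mul_le_mul_of_nonneg_right hκ (Nat.cast_nonneg n)

end LinearisedBridge

end Summit.AnomalousDissipation.AnomalousDissipation.Theorems.DenseLoudDesignerForces.Ergodic

end
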